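import Literature.MathematicalPhysics.QuantumManyBody.PeriodicTorusByParts
import Literature.MathematicalPhysics.QuantumManyBody.PuffCubicMomentSums
import HarnessLib

/-!
# Puff's cubic moment, II: the pair blocks `∫ E_{jl} (κu + 2i∂ₗu)(κ²u - 4iκ∂ⱼu - 4∂ⱼ∂ⱼu + 2i(∂ⱼV)u)`

Topic `Literature/MathematicalPhysics/QuantumManyBody`; companion of `PuffCubicMomentOperator.lean`.
With the notation there (`k = 2πm/L`, `κ = ‖k‖²`, `eⱼ = e^{ik·xⱼ}`, `∂ⱼ = k·∇_{xⱼ}`, real `u`, `V`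
on the torus `(ℝ³/Lℤ³)^N`), the pairing `⟨A, (H-E)A⟩ = ∫ conj(A) B` of Puff's cubic moment is the
double sum over particles `j, l` of the **pair blocks**

  `I_{jl} = ∫ E_{jl} (κu + 2i ∂ₗu) (κ²u - 4iκ ∂ⱼu - 4 ∂ⱼ∂ⱼu + 2i (∂ⱼV) u)`,  `E_{jl} = eⱼ ēₗ`.

`puff_block_integral` evaluates every block by periodic integration by parts (no equation for `u`
is needed here; `u, V ∈ C²` lattice periodic): with `α_{jl} = κ` for `j ≠ l` and `α_{jj} = 0`
(so that `∂ⱼE_{jl} = iαE_{jl}`, `∂ₗE_{jl} = -iαE_{jl}`),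

  `I_{jl} = ∫ E_{jl} (κ(κ-α)(κ-2α) u² + 4(κ-α)(∂ⱼu)² + 8(κ-α) ∂ₗu ∂ⱼu + 2i(κ-α)(∂ⱼV)u² + 2(∂ₗ∂ⱼV)u²)`.

All kinetic cross terms of the off-diagonal blocks cancel (`α = κ`); the diagonal blocks give
`κ³∫u² + 12κ∫(∂ⱼu)² + 2iκ∫(∂ⱼV)u² + 2∫(∂ⱼ∂ⱼV)u²` (`12 = 4 + 8`) [Puff1965, (12)–(15); Stringari1995,
§2.3 (23)]. Proof: two periodic fluxes with `block - target = ∂ⱼΦ₁ + ∂ₗΦ₂` pointwise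
(`puff_block_algebra` of `PuffCubicMomentSums.lean`). Summing the blocks gives
`puff_cubic_moment_pairing`: `Re ∫ conj(A) B = N κ³ ∫u² + 12κ ∫∑ⱼ(∂ⱼu)² + 2 Re ∫ u² ∑_{j,l} E_{jl}∂ₗ∂ⱼV`
(`A = ∑ⱼ eⱼ(κu - 2i∂ⱼu)`, `B = ∑ⱼ eⱼ(κ²u - 4iκ∂ⱼu - 4∂ⱼ∂ⱼu + 2i(∂ⱼV)u)`), Puff's cubic moment once
`B = (H-E)A` (`PuffCubicMomentOperator.lean`). No definitions; `[folklore]` except as cited.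
-/

noncomputable section

open MeasureTheory
open scoped ENNReal NNReal ComplexConjugate

namespace Literature.MathematicalPhysics.QuantumManyBody.BoseGas

variable {N : ℕ}

/-! ### One block: fluxes, pointwise identity, integration by parts -/

section Block

variable {L : ℝ} (m : Fin 3 → ℤ) {k : Space} {u V : Config N → ℝ}

/-- **Puff's pair block.** For real `C²` lattice-periodic `u, V` on the torus of side `L > 0`, a mode
`m` (`k = 2πm/L`, `κ = ‖k‖²`, `∂ⱼ = k·∇_{xⱼ}`, `E_{jl} = eⱼēₗ`, `α_{jl} = κ[j ≠ l]`) and particles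
`j, l`:
`∫ E_{jl}(κu + 2i∂ₗu)(κ²u - 4iκ∂ⱼu - 4∂ⱼ∂ⱼu + 2i(∂ⱼV)u)
 = ∫ E_{jl}(κ(κ-α)(κ-2α)u² + 4(κ-α)(∂ⱼu)² + 8(κ-α)∂ₗu∂ⱼu + 2i(κ-α)(∂ⱼV)u² + 2(∂ₗ∂ⱼV)u²)`
over the fundamental cell (six periodic integrations by parts, packaged as two fluxes).
[cite: Puff1965, (12)–(15)] -/
theorem puff_block_integral (hL : 0 < L) (hk : k = (2 * Real.pi / L) • latticeVec 1 m)
    (hu : ContDiff ℝ 2 u) (hV : ContDiff ℝ 2 V) (huper : IsLatticePeriodic L u)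
    (hVper : IsLatticePeriodic L V) (j l : Fin N) :
    ∫ X in cellN N L, cellWave L m (X j) * conj (cellWave L m (X l)) *
        (((((‖k‖ ^ 2 : ℝ) : ℂ)) * ((u X : ℝ) : ℂ) + 2 * Complex.I * ((fderiv ℝ u X (Pi.single l k) : ℝ) : ℂ)) *
          ((((‖k‖ ^ 2 : ℝ) : ℂ)) ^ 2 * ((u X : ℝ) : ℂ) -
            4 * Complex.I * ((‖k‖ ^ 2 : ℝ) : ℂ) * ((fderiv ℝ u X (Pi.single j k) : ℝ) : ℂ) -
            4 * ((fderiv ℝ (fun Y => fderiv ℝ u Y (Pi.single j k)) X (Pi.single j k) : ℝ) : ℂ) +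
            2 * Complex.I * ((fderiv ℝ V X (Pi.single j k) : ℝ) : ℂ) * ((u X : ℝ) : ℂ))) =
      ∫ X in cellN N L, cellWave L m (X j) * conj (cellWave L m (X l)) *
        (((‖k‖ ^ 2 : ℝ) : ℂ) * (((‖k‖ ^ 2 : ℝ) : ℂ) - (((if j = l then (0 : ℝ) else ‖k‖ ^ 2) : ℝ) : ℂ)) *
            (((‖k‖ ^ 2 : ℝ) : ℂ) - 2 * (((if j = l then (0 : ℝ) else ‖k‖ ^ 2) : ℝ) : ℂ)) *
            (((u X : ℝ) : ℂ) * ((u X : ℝ) : ℂ)) +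
          4 * (((‖k‖ ^ 2 : ℝ) : ℂ) - (((if j = l then (0 : ℝ) else ‖k‖ ^ 2) : ℝ) : ℂ)) *
            (((fderiv ℝ u X (Pi.single j k) : ℝ) : ℂ) * ((fderiv ℝ u X (Pi.single j k) : ℝ) : ℂ)) +
          8 * (((‖k‖ ^ 2 : ℝ) : ℂ) - (((if j = l then (0 : ℝ) else ‖k‖ ^ 2) : ℝ) : ℂ)) *
            (((fderiv ℝ u X (Pi.single l k) : ℝ) : ℂ) * ((fderiv ℝ u X (Pi.single j k) : ℝ) : ℂ)) +
          2 * Complex.I * (((‖k‖ ^ 2 : ℝ) : ℂ) - (((if j = l then (0 : ℝ) else ‖k‖ ^ 2) : ℝ) : ℂ)) *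
            (((fderiv ℝ V X (Pi.single j k) : ℝ) : ℂ) * (((u X : ℝ) : ℂ) * ((u X : ℝ) : ℂ))) +
          2 * (((fderiv ℝ (fun Y => fderiv ℝ V Y (Pi.single j k)) X (Pi.single l k) : ℝ) : ℂ) *
            (((u X : ℝ) : ℂ) * ((u X : ℝ) : ℂ)))) := by
  -- directions, constants, atoms
  set p : Config N := Pi.single j k with hp
  set p' : Config N := Pi.single l k with hp'
  set κ : ℂ := ((‖k‖ ^ 2 : ℝ) : ℂ) with hκ
  set α : ℂ := (((if j = l then (0 : ℝ) else ‖k‖ ^ 2) : ℝ) : ℂ) with hα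
  set Ef : Config N → ℂ := fun Y => cellWave L m (Y j) * conj (cellWave L m (Y l)) with hEf
  set uC : Config N → ℂ := fun Y => ((u Y : ℝ) : ℂ) with huC
  set dC : Config N → ℂ := fun Y => ((fderiv ℝ u Y p : ℝ) : ℂ) with hdC
  set d'C : Config N → ℂ := fun Y => ((fderiv ℝ u Y p' : ℝ) : ℂ) with hd'C
  set VjC : Config N → ℂ := fun Y => ((fderiv ℝ V Y p : ℝ) : ℂ) with hVjC
  -- smoothness of the atoms
  have hud : Differentiable ℝ u := hu.differentiable two_ne_zero
  have hVd : Differentiable ℝ V := hV.differentiable two_ne_zero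
  have hd1 : ContDiff ℝ 1 (fun Y => fderiv ℝ u Y p) := contDiff_one_fderiv_apply_const hu p
  have hd1' : ContDiff ℝ 1 (fun Y => fderiv ℝ u Y p') := contDiff_one_fderiv_apply_const hu p'
  have hV1 : ContDiff ℝ 1 (fun Y => fderiv ℝ V Y p) := contDiff_one_fderiv_apply_const hV p
  have hEC : ContDiff ℝ 1 Ef := contDiff_pairPhase L m j l
  have huCC : ContDiff ℝ 1 uC := contDiff_ofReal_comp (hu.of_le (by norm_num))
  have hdCC : ContDiff ℝ 1 dC := contDiff_ofReal_comp hd1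
  have hd'CC : ContDiff ℝ 1 d'C := contDiff_ofReal_comp hd1'
  have hVjCC : ContDiff ℝ 1 VjC := contDiff_ofReal_comp hV1
  have hEd : Differentiable ℝ Ef := hEC.differentiable one_ne_zero
  have huCd : Differentiable ℝ uC := huCC.differentiable one_ne_zero
  have hdCd : Differentiable ℝ dC := hdCC.differentiable one_ne_zero
  have hd'Cd : Differentiable ℝ d'C := hd'CC.differentiable one_ne_zero
  have hVjCd : Differentiable ℝ VjC := hVjCC.differentiable one_ne_zero
  -- derivatives of the atoms
  have hE1 : ∀ X, fderiv ℝ Ef X p = Complex.I * α * Ef X := fun X => fderiv_pairPhase_left L m hk j l X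
  have hE2 : ∀ X, fderiv ℝ Ef X p' = -(Complex.I * α) * Ef X := fun X =>
    fderiv_pairPhase_right L m hk j l X
  have hu1 : ∀ X, fderiv ℝ uC X p = dC X := fun X => fderiv_ofReal_apply (hud X) p
  have hu2 : ∀ X, fderiv ℝ uC X p' = d'C X := fun X => fderiv_ofReal_apply (hud X) p'
  have hdd1 : ∀ X, fderiv ℝ dC X p =
      ((fderiv ℝ (fun Y => fderiv ℝ u Y p) X p : ℝ) : ℂ) := fun X =>
    fderiv_ofReal_apply (hd1.differentiable one_ne_zero X) p
  have hdd2 : ∀ X, fderiv ℝ dC X p' =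
      ((fderiv ℝ (fun Y => fderiv ℝ u Y p) X p' : ℝ) : ℂ) := fun X =>
    fderiv_ofReal_apply (hd1.differentiable one_ne_zero X) p'
  have hd'1 : ∀ X, fderiv ℝ d'C X p =
      ((fderiv ℝ (fun Y => fderiv ℝ u Y p) X p' : ℝ) : ℂ) := fun X => by
    rw [hd'C, fderiv_ofReal_apply (hd1'.differentiable one_ne_zero X) p,
      fderiv_fderiv_apply_comm hu X p' p]
  have hVj2 : ∀ X, fderiv ℝ VjC X p' =
      ((fderiv ℝ (fun Y => fderiv ℝ V Y p) X p' : ℝ) : ℂ) := fun X =>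
    fderiv_ofReal_apply (hV1.differentiable one_ne_zero X) p'
  -- product atoms (lambda form)
  have huu : ∀ X, DifferentiableAt ℝ (fun Y => uC Y * uC Y) X := fun X => (huCd X).mul (huCd X)
  have hud' : ∀ X, DifferentiableAt ℝ (fun Y => uC Y * dC Y) X := fun X => (huCd X).mul (hdCd X)
  have hd'd : ∀ X, DifferentiableAt ℝ (fun Y => d'C Y * dC Y) X := fun X => (hd'Cd X).mul (hdCd X)
  have hdd : ∀ X, DifferentiableAt ℝ (fun Y => dC Y * dC Y) X := fun X => (hdCd X).mul (hdCd X)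
  have hVuu : ∀ X, DifferentiableAt ℝ (fun Y => VjC Y * (uC Y * uC Y)) X :=
    fun X => (hVjCd X).mul (huu X)
  -- the fluxes
  set Φ₁ : Config N → ℂ := fun Y => Ef Y * ((-2 * Complex.I * κ ^ 2 + 2 * Complex.I * κ * α) *
    (uC Y * uC Y) + (-4 * κ) * (uC Y * dC Y) + (-8 * Complex.I) * (d'C Y * dC Y)) with hΦ₁
  set Φ₂ : Config N → ℂ := fun Y => Ef Y * ((Complex.I * κ ^ 2) * (uC Y * uC Y) +
    (4 * Complex.I) * (dC Y * dC Y) + (-2) * (VjC Y * (uC Y * uC Y))) with hΦ₂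
  have hΦ₁' : ∀ X, fderiv ℝ Φ₁ X p = Complex.I * α * Ef X *
      ((-2 * Complex.I * κ ^ 2 + 2 * Complex.I * κ * α) * (uC X * uC X) + (-4 * κ) * (uC X * dC X) +
        (-8 * Complex.I) * (d'C X * dC X)) +
      Ef X * ((-2 * Complex.I * κ ^ 2 + 2 * Complex.I * κ * α) * (dC X * uC X + uC X * dC X) +
        (-4 * κ) * (dC X * dC X + uC X * ((fderiv ℝ (fun Y => fderiv ℝ u Y p) X p : ℝ) : ℂ)) +
        (-8 * Complex.I) * (((fderiv ℝ (fun Y => fderiv ℝ u Y p) X p' : ℝ) : ℂ) * dC X +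
          d'C X * ((fderiv ℝ (fun Y => fderiv ℝ u Y p) X p : ℝ) : ℂ))) := by
    intro X
    have hR : DifferentiableAt ℝ (fun Y => (-2 * Complex.I * κ ^ 2 + 2 * Complex.I * κ * α) *
        (uC Y * uC Y) + (-4 * κ) * (uC Y * dC Y) + (-8 * Complex.I) * (d'C Y * dC Y)) X :=
      (((huu X).const_mul _).add ((hud' X).const_mul _)).add ((hd'd X).const_mul _)
    rw [hΦ₁, fderiv_mul_apply (hEd X) hR, hE1, fderiv_lincomb₃_apply (huu X) (hud' X) (hd'd X),
      fderiv_mul_apply (huCd X) (huCd X), fderiv_mul_apply (huCd X) (hdCd X),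
      fderiv_mul_apply (hd'Cd X) (hdCd X), hu1, hdd1, hd'1]
  have hΦ₂' : ∀ X, fderiv ℝ Φ₂ X p' = -(Complex.I * α) * Ef X *
      ((Complex.I * κ ^ 2) * (uC X * uC X) + (4 * Complex.I) * (dC X * dC X) +
        (-2) * (VjC X * (uC X * uC X))) +
      Ef X * ((Complex.I * κ ^ 2) * (d'C X * uC X + uC X * d'C X) +
        (4 * Complex.I) * (((fderiv ℝ (fun Y => fderiv ℝ u Y p) X p' : ℝ) : ℂ) * dC X +
          dC X * ((fderiv ℝ (fun Y => fderiv ℝ u Y p) X p' : ℝ) : ℂ)) +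
        (-2) * (((fderiv ℝ (fun Y => fderiv ℝ V Y p) X p' : ℝ) : ℂ) * (uC X * uC X) +
          VjC X * (d'C X * uC X + uC X * d'C X))) := by
    intro X
    have hR : DifferentiableAt ℝ (fun Y => (Complex.I * κ ^ 2) * (uC Y * uC Y) +
        (4 * Complex.I) * (dC Y * dC Y) + (-2) * (VjC Y * (uC Y * uC Y))) X :=
      (((huu X).const_mul _).add ((hdd X).const_mul _)).add ((hVuu X).const_mul _)
    rw [hΦ₂, fderiv_mul_apply (hEd X) hR, hE2, fderiv_lincomb₃_apply (huu X) (hdd X) (hVuu X),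
      fderiv_mul_apply (huCd X) (huCd X), fderiv_mul_apply (hdCd X) (hdCd X),
      fderiv_mul_apply (hVjCd X) (huu X), fderiv_mul_apply (huCd X) (huCd X), hu2, hdd2, hVj2]
  -- the pointwise identity `block = target + ∂ⱼΦ₁ + ∂ₗΦ₂`
  have hpt : ∀ X, Ef X * ((κ * uC X + 2 * Complex.I * d'C X) * (κ ^ 2 * uC X -
      4 * Complex.I * κ * dC X - 4 * ((fderiv ℝ (fun Y => fderiv ℝ u Y p) X p : ℝ) : ℂ) +
      2 * Complex.I * VjC X * uC X)) =
      Ef X * (κ * (κ - α) * (κ - 2 * α) * (uC X * uC X) + 4 * (κ - α) * (dC X * dC X) +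
        8 * (κ - α) * (d'C X * dC X) + 2 * Complex.I * (κ - α) * (VjC X * (uC X * uC X)) +
        2 * (((fderiv ℝ (fun Y => fderiv ℝ V Y p) X p' : ℝ) : ℂ) * (uC X * uC X))) +
      fderiv ℝ Φ₁ X p + fderiv ℝ Φ₂ X p' := by
    intro X
    rw [hΦ₁', hΦ₂']
    have key := puff_block_algebra (Ef X) (‖k‖ ^ 2) (if j = l then (0 : ℝ) else ‖k‖ ^ 2) (u X)
      (fderiv ℝ u X p) (fderiv ℝ u X p') (fderiv ℝ (fun Y => fderiv ℝ u Y p) X p)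
      (fderiv ℝ (fun Y => fderiv ℝ u Y p) X p') (fderiv ℝ V X p) (fderiv ℝ (fun Y => fderiv ℝ V Y p) X p')
    simp only [huC, hdC, hd'C, hVjC, hκ, hα] at key ⊢
    linear_combination key
  -- periodicity and smoothness of the fluxes
  have hwave : ∀ (l : Fin N) (Y : Config N) (i : Fin N) (c : Fin 3),
      cellWave L m ((Y + Pi.single i (EuclideanSpace.single c L) : Config N) l) = cellWave L m (Y l) := by
    intro l Y i c
    rw [Pi.add_apply]
    by_cases hli : l = i
    · subst hli; rw [Pi.single_eq_same, cellWave_periodic hL.ne']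
    · rw [Pi.single_eq_of_ne hli, add_zero]
  have hEper : ∀ (Y : Config N) (i : Fin N) (c : Fin 3),
      Ef (Y + Pi.single i (EuclideanSpace.single c L)) = Ef Y := fun Y i c => by
    simp only [hEf, hwave]
  have huCper : ∀ (Y : Config N) (i : Fin N) (c : Fin 3),
      uC (Y + Pi.single i (EuclideanSpace.single c L)) = uC Y := fun Y i c => by
    simp only [huC, huper Y i c]
  have hdCper : ∀ (Y : Config N) (i : Fin N) (c : Fin 3),
      dC (Y + Pi.single i (EuclideanSpace.single c L)) = dC Y := fun Y i c => by
    simp only [hdC, fderiv_apply_periodic huper]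
  have hd'Cper : ∀ (Y : Config N) (i : Fin N) (c : Fin 3),
      d'C (Y + Pi.single i (EuclideanSpace.single c L)) = d'C Y := fun Y i c => by
    simp only [hd'C, fderiv_apply_periodic huper]
  have hVjCper : ∀ (Y : Config N) (i : Fin N) (c : Fin 3),
      VjC (Y + Pi.single i (EuclideanSpace.single c L)) = VjC Y := fun Y i c => by
    simp only [hVjC, fderiv_apply_periodic hVper]
  have hΦ₁per : ∀ (Y : Config N) (i : Fin N) (c : Fin 3),
      Φ₁ (Y + Pi.single i (EuclideanSpace.single c L)) = Φ₁ Y := fun Y i c => by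
    simp only [hΦ₁, hEper, huCper, hdCper, hd'Cper]
  have hΦ₂per : ∀ (Y : Config N) (i : Fin N) (c : Fin 3),
      Φ₂ (Y + Pi.single i (EuclideanSpace.single c L)) = Φ₂ Y := fun Y i c => by
    simp only [hΦ₂, hEper, huCper, hdCper, hVjCper]
  have hΦ₁C : ContDiff ℝ 1 Φ₁ :=
    hEC.mul (((contDiff_const.mul (huCC.mul huCC)).add (contDiff_const.mul (huCC.mul hdCC))).add
      (contDiff_const.mul (hd'CC.mul hdCC)))
  have hΦ₂C : ContDiff ℝ 1 Φ₂ :=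
    hEC.mul (((contDiff_const.mul (huCC.mul huCC)).add (contDiff_const.mul (hdCC.mul hdCC))).add
      (contDiff_const.mul (hVjCC.mul (huCC.mul huCC))))
  -- integrate
  have hI1 : ∫ X in cellN N L, fderiv ℝ Φ₁ X p = 0 :=
    integral_cellN_fderiv_apply_eq_zero hL hΦ₁C hΦ₁per p
  have hI2 : ∫ X in cellN N L, fderiv ℝ Φ₂ X p' = 0 :=
    integral_cellN_fderiv_apply_eq_zero hL hΦ₂C hΦ₂per p'
  have hcont_dd : Continuous fun X => ((fderiv ℝ (fun Y => fderiv ℝ u Y p) X p : ℝ) : ℂ) :=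
    Complex.continuous_ofReal.comp (continuous_fderiv_apply_const hd1 p)
  have hcont_Vjl : Continuous fun X => ((fderiv ℝ (fun Y => fderiv ℝ V Y p) X p' : ℝ) : ℂ) :=
    Complex.continuous_ofReal.comp (continuous_fderiv_apply_const hV1 p')
  have hEc := hEC.continuous
  have huc := huCC.continuous
  have hdc := hdCC.continuous
  have hd'c := hd'CC.continuous
  have hVjc := hVjCC.continuous
  have hT : Integrable (fun X => Ef X * (κ * (κ - α) * (κ - 2 * α) * (uC X * uC X) +
      4 * (κ - α) * (dC X * dC X) + 8 * (κ - α) * (d'C X * dC X) +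
      2 * Complex.I * (κ - α) * (VjC X * (uC X * uC X)) +
      2 * (((fderiv ℝ (fun Y => fderiv ℝ V Y p) X p' : ℝ) : ℂ) * (uC X * uC X))))
      (volume.restrict (cellN N L)) := by
    refine integrableOn_cellN (hEc.mul ?_) L
    fun_prop
  have hF1 : Integrable (fun X => fderiv ℝ Φ₁ X p) (volume.restrict (cellN N L)) :=
    integrableOn_cellN (continuous_fderiv_apply_const hΦ₁C p) L
  have hF2 : Integrable (fun X => fderiv ℝ Φ₂ X p') (volume.restrict (cellN N L)) :=
    integrableOn_cellN (continuous_fderiv_apply_const hΦ₂C p') L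
  have hsplit : ∫ X in cellN N L, (Ef X * (κ * (κ - α) * (κ - 2 * α) * (uC X * uC X) +
        4 * (κ - α) * (dC X * dC X) + 8 * (κ - α) * (d'C X * dC X) +
        2 * Complex.I * (κ - α) * (VjC X * (uC X * uC X)) +
        2 * (((fderiv ℝ (fun Y => fderiv ℝ V Y p) X p' : ℝ) : ℂ) * (uC X * uC X))) +
        fderiv ℝ Φ₁ X p) + fderiv ℝ Φ₂ X p' =
      ∫ X in cellN N L, Ef X * (κ * (κ - α) * (κ - 2 * α) * (uC X * uC X) +
        4 * (κ - α) * (dC X * dC X) + 8 * (κ - α) * (d'C X * dC X) +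
        2 * Complex.I * (κ - α) * (VjC X * (uC X * uC X)) +
        2 * (((fderiv ℝ (fun Y => fderiv ℝ V Y p) X p' : ℝ) : ℂ) * (uC X * uC X))) := by
    have hTF : Integrable (fun X => Ef X * (κ * (κ - α) * (κ - 2 * α) * (uC X * uC X) +
        4 * (κ - α) * (dC X * dC X) + 8 * (κ - α) * (d'C X * dC X) +
        2 * Complex.I * (κ - α) * (VjC X * (uC X * uC X)) +
        2 * (((fderiv ℝ (fun Y => fderiv ℝ V Y p) X p' : ℝ) : ℂ) * (uC X * uC X))) +
        fderiv ℝ Φ₁ X p) (volume.restrict (cellN N L)) := hT.add hF1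
    rw [integral_add hTF hF2, integral_add hT hF1, hI1, hI2, add_zero, add_zero]
  calc _ = ∫ X in cellN N L, (Ef X * (κ * (κ - α) * (κ - 2 * α) * (uC X * uC X) +
        4 * (κ - α) * (dC X * dC X) + 8 * (κ - α) * (d'C X * dC X) +
        2 * Complex.I * (κ - α) * (VjC X * (uC X * uC X)) +
        2 * (((fderiv ℝ (fun Y => fderiv ℝ V Y p) X p' : ℝ) : ℂ) * (uC X * uC X))) +
        fderiv ℝ Φ₁ X p) + fderiv ℝ Φ₂ X p' :=
        integral_congr_ae (ae_of_all _ hpt)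
    _ = _ := hsplit

end Block

/-! ### Puff's identity -/

section Pairing

variable {L : ℝ} (m : Fin 3 → ℤ) {k : Space} {u V : Config N → ℝ}

/-- **Puff's cubic moment pairing.** For real `C²` lattice-periodic `u, V` on the torus of side
`L > 0` and a mode `m` (`k = 2πm/L`, `κ = ‖k‖²`, `eⱼ = e^{ik·xⱼ}`, `∂ⱼ = k·∇_{xⱼ}`), with
`A = ∑ⱼ eⱼ(κu - 2i∂ⱼu)` and `B = ∑ⱼ eⱼ(κ²u - 4iκ∂ⱼu - 4∂ⱼ∂ⱼu + 2i(∂ⱼV)u)`: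
`Re ∫ conj(A) B = κ³ N ∫ u² + 12 κ ∫ ∑ⱼ (∂ⱼu)² + 2 Re ∫ u² ∑_{j,l} eⱼēₗ ∂ₗ∂ⱼV`
(all kinetic cross terms between different particles cancel). [cite: Puff1965, (15)] -/
theorem puff_cubic_moment_pairing (hL : 0 < L) (hk : k = (2 * Real.pi / L) • latticeVec 1 m)
    (hu : ContDiff ℝ 2 u) (hV : ContDiff ℝ 2 V) (huper : IsLatticePeriodic L u)
    (hVper : IsLatticePeriodic L V) :
    (∫ X in cellN N L, conj (∑ j : Fin N, cellWave L m (X j) *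
        ((((‖k‖ ^ 2 : ℝ) : ℂ)) * ((u X : ℝ) : ℂ) - 2 * Complex.I * ((fderiv ℝ u X (Pi.single j k) : ℝ) : ℂ))) *
      ∑ j : Fin N, cellWave L m (X j) *
        ((((‖k‖ ^ 2 : ℝ) : ℂ)) ^ 2 * ((u X : ℝ) : ℂ) -
          4 * Complex.I * ((‖k‖ ^ 2 : ℝ) : ℂ) * ((fderiv ℝ u X (Pi.single j k) : ℝ) : ℂ) -
          4 * ((fderiv ℝ (fun Y => fderiv ℝ u Y (Pi.single j k)) X (Pi.single j k) : ℝ) : ℂ) +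
          2 * Complex.I * ((fderiv ℝ V X (Pi.single j k) : ℝ) : ℂ) * ((u X : ℝ) : ℂ))).re =
      ‖k‖ ^ 6 * N * (∫ X in cellN N L, u X ^ 2) +
        12 * ‖k‖ ^ 2 * (∫ X in cellN N L, ∑ j : Fin N, fderiv ℝ u X (Pi.single j k) ^ 2) +
        2 * (∫ X in cellN N L, ((u X ^ 2 : ℝ) : ℂ) * ∑ j : Fin N, ∑ l : Fin N,
          cellWave L m (X j) * conj (cellWave L m (X l)) *
            ((fderiv ℝ (fun Y => fderiv ℝ V Y (Pi.single j k)) X (Pi.single l k) : ℝ) : ℂ)).re := by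
  -- continuity of the atoms
  have hce : ∀ j : Fin N, Continuous fun X : Config N => cellWave L m (X j) := fun j =>
    (contDiff_cellWave L m).continuous.comp (continuous_apply j)
  have huc : Continuous u := hu.continuous
  have hc1 : ∀ w : Config N, Continuous fun X => fderiv ℝ u X w := fun w =>
    continuous_fderiv_apply_const (hu.of_le (by norm_num)) w
  have hc2 : ∀ w w' : Config N, Continuous fun X => fderiv ℝ (fun Y => fderiv ℝ u Y w) X w' :=
    fun w w' => continuous_fderiv_apply_const (contDiff_one_fderiv_apply_const hu w) w'
  have hc3 : ∀ w : Config N, Continuous fun X => fderiv ℝ V X w := fun w =>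
    continuous_fderiv_apply_const (hV.of_le (by norm_num)) w
  have hc4 : ∀ w w' : Config N, Continuous fun X => fderiv ℝ (fun Y => fderiv ℝ V Y w) X w' :=
    fun w w' => continuous_fderiv_apply_const (contDiff_one_fderiv_apply_const hV w) w'
  -- Step 1: blocks
  simp_rw [conj_A_mul_B_eq_sum_blocks m]
  have hblk : ∀ j l : Fin N, Integrable (fun X => cellWave L m (X j) * conj (cellWave L m (X l)) *
      (((((‖k‖ ^ 2 : ℝ) : ℂ)) * ((u X : ℝ) : ℂ) + 2 * Complex.I * ((fderiv ℝ u X (Pi.single l k) : ℝ) : ℂ)) *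
        ((((‖k‖ ^ 2 : ℝ) : ℂ)) ^ 2 * ((u X : ℝ) : ℂ) -
          4 * Complex.I * ((‖k‖ ^ 2 : ℝ) : ℂ) * ((fderiv ℝ u X (Pi.single j k) : ℝ) : ℂ) -
          4 * ((fderiv ℝ (fun Y => fderiv ℝ u Y (Pi.single j k)) X (Pi.single j k) : ℝ) : ℂ) +
          2 * Complex.I * ((fderiv ℝ V X (Pi.single j k) : ℝ) : ℂ) * ((u X : ℝ) : ℂ))))
      (volume.restrict (cellN N L)) := by
    intro j l
    have h1 := hce j; have h2 := hce l; have h3 := hc1 (Pi.single l k); have h4 := hc1 (Pi.single j k)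
    have h5 := hc2 (Pi.single j k) (Pi.single j k); have h6 := hc3 (Pi.single j k)
    exact integrableOn_cellN (by fun_prop) L
  have htar : ∀ j l : Fin N, Integrable (fun X => cellWave L m (X j) * conj (cellWave L m (X l)) *
      (((‖k‖ ^ 2 : ℝ) : ℂ) * (((‖k‖ ^ 2 : ℝ) : ℂ) - (((if j = l then (0 : ℝ) else ‖k‖ ^ 2) : ℝ) : ℂ)) *
          (((‖k‖ ^ 2 : ℝ) : ℂ) - 2 * (((if j = l then (0 : ℝ) else ‖k‖ ^ 2) : ℝ) : ℂ)) *
          (((u X : ℝ) : ℂ) * ((u X : ℝ) : ℂ)) +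
        4 * (((‖k‖ ^ 2 : ℝ) : ℂ) - (((if j = l then (0 : ℝ) else ‖k‖ ^ 2) : ℝ) : ℂ)) *
          (((fderiv ℝ u X (Pi.single j k) : ℝ) : ℂ) * ((fderiv ℝ u X (Pi.single j k) : ℝ) : ℂ)) +
        8 * (((‖k‖ ^ 2 : ℝ) : ℂ) - (((if j = l then (0 : ℝ) else ‖k‖ ^ 2) : ℝ) : ℂ)) *
          (((fderiv ℝ u X (Pi.single l k) : ℝ) : ℂ) * ((fderiv ℝ u X (Pi.single j k) : ℝ) : ℂ)) +
        2 * Complex.I * (((‖k‖ ^ 2 : ℝ) : ℂ) - (((if j = l then (0 : ℝ) else ‖k‖ ^ 2) : ℝ) : ℂ)) *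
          (((fderiv ℝ V X (Pi.single j k) : ℝ) : ℂ) * (((u X : ℝ) : ℂ) * ((u X : ℝ) : ℂ))) +
        2 * (((fderiv ℝ (fun Y => fderiv ℝ V Y (Pi.single j k)) X (Pi.single l k) : ℝ) : ℂ) *
          (((u X : ℝ) : ℂ) * ((u X : ℝ) : ℂ)))))
      (volume.restrict (cellN N L)) := by
    intro j l
    have h1 := hce j; have h2 := hce l; have h3 := hc1 (Pi.single l k); have h4 := hc1 (Pi.single j k)
    have h6 := hc3 (Pi.single j k); have h7 := hc4 (Pi.single j k) (Pi.single l k)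
    exact integrableOn_cellN (by fun_prop) L
  rw [integral_finsetSum _ fun j _ => integrable_finsetSum _ fun l _ => hblk j l]
  rw [Finset.sum_congr rfl fun j _ => integral_finsetSum _ fun l _ => hblk j l]
  rw [Finset.sum_congr rfl fun j _ => Finset.sum_congr rfl fun l _ =>
    puff_block_integral m hL hk hu hV huper hVper j l]
  rw [← Finset.sum_congr rfl fun j _ => integral_finsetSum _ fun l _ => htar j l]
  rw [← integral_finsetSum _ fun j _ => integrable_finsetSum _ fun l _ => htar j l]
  simp_rw [sum_blockTarget_eq m]
  -- Step 2: split the integral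
  have hI1 : Integrable (fun X => ((‖k‖ ^ 2 : ℝ) : ℂ) ^ 3 * N * (((u X : ℝ) : ℂ) * ((u X : ℝ) : ℂ)))
      (volume.restrict (cellN N L)) := integrableOn_cellN (by fun_prop) L
  have hI2 : Integrable (fun X => 12 * ((‖k‖ ^ 2 : ℝ) : ℂ) *
      ∑ j : Fin N, ((fderiv ℝ u X (Pi.single j k) : ℝ) : ℂ) * ((fderiv ℝ u X (Pi.single j k) : ℝ) : ℂ))
      (volume.restrict (cellN N L)) := by
    refine integrableOn_cellN (continuous_const.mul (continuous_finsetSum _ fun j _ => ?_)) L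
    have h4 := hc1 (Pi.single j k)
    fun_prop
  have hI3 : Integrable (fun X => 2 * Complex.I * ((‖k‖ ^ 2 : ℝ) : ℂ) *
      ∑ j : Fin N, ((fderiv ℝ V X (Pi.single j k) : ℝ) : ℂ) * (((u X : ℝ) : ℂ) * ((u X : ℝ) : ℂ)))
      (volume.restrict (cellN N L)) := by
    refine integrableOn_cellN (continuous_const.mul (continuous_finsetSum _ fun j _ => ?_)) L
    have h6 := hc3 (Pi.single j k)
    fun_prop
  have hI4 : Integrable (fun X => 2 * ((((u X : ℝ) : ℂ) * ((u X : ℝ) : ℂ)) * ∑ j : Fin N, ∑ l : Fin N,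
      cellWave L m (X j) * conj (cellWave L m (X l)) *
        ((fderiv ℝ (fun Y => fderiv ℝ V Y (Pi.single j k)) X (Pi.single l k) : ℝ) : ℂ)))
      (volume.restrict (cellN N L)) := by
    refine integrableOn_cellN (continuous_const.mul ((by fun_prop : Continuous fun X : Config N =>
      ((u X : ℝ) : ℂ) * ((u X : ℝ) : ℂ)).mul
      (continuous_finsetSum _ fun j _ => continuous_finsetSum _ fun l _ => ?_))) L
    have h1 := hce j; have h2 := hce l; have h7 := hc4 (Pi.single j k) (Pi.single l k)
    fun_prop
  have h12 : Integrable (fun X => ((‖k‖ ^ 2 : ℝ) : ℂ) ^ 3 * N * (((u X : ℝ) : ℂ) * ((u X : ℝ) : ℂ)) +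
      12 * ((‖k‖ ^ 2 : ℝ) : ℂ) *
        ∑ j : Fin N, ((fderiv ℝ u X (Pi.single j k) : ℝ) : ℂ) * ((fderiv ℝ u X (Pi.single j k) : ℝ) : ℂ))
      (volume.restrict (cellN N L)) := hI1.add hI2
  have h123 : Integrable (fun X => ((‖k‖ ^ 2 : ℝ) : ℂ) ^ 3 * N * (((u X : ℝ) : ℂ) * ((u X : ℝ) : ℂ)) +
      12 * ((‖k‖ ^ 2 : ℝ) : ℂ) *
        ∑ j : Fin N, ((fderiv ℝ u X (Pi.single j k) : ℝ) : ℂ) * ((fderiv ℝ u X (Pi.single j k) : ℝ) : ℂ) +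
      2 * Complex.I * ((‖k‖ ^ 2 : ℝ) : ℂ) *
        ∑ j : Fin N, ((fderiv ℝ V X (Pi.single j k) : ℝ) : ℂ) * (((u X : ℝ) : ℂ) * ((u X : ℝ) : ℂ)))
      (volume.restrict (cellN N L)) := h12.add hI3
  rw [integral_add h123 hI4, integral_add h12 hI3, integral_add hI1 hI2,
    integral_const_mul, integral_const_mul, integral_const_mul, integral_const_mul]
  -- Step 3: real parts
  have hJ1 : ∫ X in cellN N L, ((u X : ℝ) : ℂ) * ((u X : ℝ) : ℂ) = ((∫ X in cellN N L, u X ^ 2 : ℝ) : ℂ) := by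
    rw [← integral_complex_ofReal]
    exact integral_congr_ae (ae_of_all _ fun X => by push_cast; ring)
  have hJ2 : ∫ X in cellN N L, ∑ j : Fin N, ((fderiv ℝ u X (Pi.single j k) : ℝ) : ℂ) *
      ((fderiv ℝ u X (Pi.single j k) : ℝ) : ℂ) =
      ((∫ X in cellN N L, ∑ j : Fin N, fderiv ℝ u X (Pi.single j k) ^ 2 : ℝ) : ℂ) := by
    rw [← integral_complex_ofReal]
    exact integral_congr_ae (ae_of_all _ fun X => by push_cast; exact Finset.sum_congr rfl fun j _ => by ring)
  have hJ3 : ∫ X in cellN N L, ∑ j : Fin N, ((fderiv ℝ V X (Pi.single j k) : ℝ) : ℂ) *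
      (((u X : ℝ) : ℂ) * ((u X : ℝ) : ℂ)) =
      ((∫ X in cellN N L, ∑ j : Fin N, fderiv ℝ V X (Pi.single j k) * (u X * u X) : ℝ) : ℂ) := by
    rw [← integral_complex_ofReal]
    exact integral_congr_ae (ae_of_all _ fun X => by push_cast; rfl)
  have hJ4 : ∫ X in cellN N L, (((u X : ℝ) : ℂ) * ((u X : ℝ) : ℂ)) * ∑ j : Fin N, ∑ l : Fin N,
      cellWave L m (X j) * conj (cellWave L m (X l)) *
        ((fderiv ℝ (fun Y => fderiv ℝ V Y (Pi.single j k)) X (Pi.single l k) : ℝ) : ℂ) =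
      ∫ X in cellN N L, ((u X ^ 2 : ℝ) : ℂ) * ∑ j : Fin N, ∑ l : Fin N,
      cellWave L m (X j) * conj (cellWave L m (X l)) *
        ((fderiv ℝ (fun Y => fderiv ℝ V Y (Pi.single j k)) X (Pi.single l k) : ℝ) : ℂ) :=
    integral_congr_ae (ae_of_all _ fun X => by push_cast; ring)
  rw [hJ1, hJ2, hJ3, hJ4, ← Complex.ofReal_pow]
  simp only [Complex.add_re, Complex.mul_re, Complex.mul_im, Complex.ofReal_re, Complex.ofReal_im,
    Complex.I_re, Complex.I_im, Complex.re_ofNat, Complex.im_ofNat, Complex.natCast_re, Complex.natCast_im]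
  ring

end Pairing

end Literature.MathematicalPhysics.QuantumManyBody.BoseGas

end
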